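import Summits.CriticalPhenomena.SAWScalingLimit.Theses.SAWTotalPositivity
import Summits.CriticalPhenomena.SAWScalingLimit.Theorems.CriticalBubbleBound.Negative.CriticalBubbleBoundSufficient
import Summits.CriticalPhenomena.SAWScalingLimit.Theorems.CriticalBubbleBound.Negative.CriticalBubbleBoundOneNumber
import Summits.CriticalPhenomena.SAWScalingLimit.Theorems.CriticalBubbleBound.Negative.CriticalBubbleBoundFreeEndpointFalse
import Summits.CriticalPhenomena.SAWScalingLimit.Theorems.CriticalBubbleBound.Negative.CriticalBubbleBoundSupercriticalFalse
import Summits.CriticalPhenomena.SAWScalingLimit.Theorems.CriticalBubbleBound.Negative.CriticalBubbleBoundRandomWalkFalse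
import Summits.CriticalPhenomena.SAWScalingLimit.Theorems.CriticalBubbleBound.Negative.CriticalBubbleBoundBubbleConditionFalse
import Literature.Probability.RandomPlanarGeometry.SAWBridges
import HarnessLib.Audit

/-!
# Line `kesten-product-renewal-dictionary` — crux `CriticalBubbleBound` (stmt-CriticalPhenomena-7117)

Crux-plan skeleton (planner, 2026-08-16) for the crux idea
`Cruxes/CriticalBubbleBound/Ideas/kesten-product-renewal-dictionary.md` (triage r1: pass, pass-with-doubt,
fail — the fail (r1-3) and both sharpenings are answered below and in `Lines/kesten-product-renewal-dictionary.md`).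

**Crux** (route SAWTotalPositivity, rank 4, verbatim): `∃ C ≠ ⊤, ∀ Ω bounded, δ > 0, u ∼ v in ℤ²,
SAW.weight Ω δ u v univ ≤ C` — by the landed normal form
`Negative.criticalBubbleBound_iff_bubble_e₀_ne_top` + `Negative.latticeKernel_zero_eq_tsum_countAt` it is ONE
number: `rootedSeries = Σ_n c_n(0,e₀) x_c^n < ∞` (`e₀ = (1,0)`; `= x_c + Σ_{m≥4} (m/2) p_m x_c^{m-1}`,
numerically ≈ 0.81; open since Madras–Slade 1993, p. 37).

**Lever (the dictionary).** Kesten's critical renewal structure: i.i.d. irreducible bridges drawn with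
probability `μ^{-|β|}` (a probability law because `Σ_irr x_c^{|β|} = 1`, MS (4.2.4)) make every `x_c`-weighted
sum over BRIDGES an expectation for a heavy-tailed 2D renewal walk `(S_k) = (span, transverse displacement)`:
`Σ_{W bridge, tip W = v} x_c^{|W|} = E[#k : S_k = v]` (MS (8.1.18)), `u_h := Σ_{span W = h} x_c^{|W|} =
P(renewal at level h)`. The ROOT of the crux is kept as a LENGTH weight and the rooted polygon is put into
the product space of TWO independent Kesten walks: cutting a rooted critical polygon at its lexicographically
lowest vertex `B` and at the top vertex `A` of its rightmost column gives two bridges from the transversally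
adjacent starts `B - e₁`, `B - e₁ + e₂` to the common apex `A`, vertex-disjoint otherwise, of total length
`|P| + 1` (stub A). Slicing by the apex column `h`, the crux becomes `Σ_h M₂(h) < ∞` for the
length-weighted mass `M₂(h)` of such DISJOINT apex-meeting pairs; the free (no avoidance) mass `F(h)`
factorises through one-walk renewal quantities (`freePairMass_le`, proved here: `F(h) ≤ 2 u_h sup_v L(v)`),
and the line's bet is the non-intersection gain of two INDEPENDENT regenerating walks (stub C).

**Exponent ledger** (Nienhuis/LSW values, heuristic; what each stub asserts is the one-sided bound):
`u_h ≍ h^{-1/4}` (stub B2, `≤`), `sup_{v₀=h} L(v) ≍ h^{4/3}·h^{-5/4} = h^{1/12}` (stub B1, `≤`), hence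
`F(h) ≲ h^{-1/6}` (divergent alone); `M₂(h)/F(h) ≍ h^{-3/2}` (two boundary two-leg fusions `3/4 + 3/4`),
of which stub C asks `≥ 5/6 + ε`; then `M₂(h) ≲ h^{-1-ε/2}` is summable. Truth for comparison:
`M₂(h) ≍ h^{-5/3}` (rooted mass `R^{-2/3}` per dyadic scale).

**Stubs** (4, registered by `ledger skeleton check`; statements `Goal.stub_*` = the defs below; hardest =
`stub_disjointnessGain`):
* A `stub_twoBridgeBound : TwoBridgeBound` (M, provable now) — `rootedSeries ≤ x_c + μ² Σ_h M₂(h)`: the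
  `n = 1` walk, plus the lexicographic two-bridge cut on translation classes `[P]` (class weight
  `h(P) x_c^{|P|-1}`, `h(P)` = #horizontal edges `≤ |P| < |W₁|+|W₂|`; pair weight
  `(|W₁|+|W₂|) x_c^{|W₁|+|W₂|} = (|P|+1) x_c^{|P|+1}`, whence the factor `μ² = x_c^{-2}` — the triage's
  off-by-one fix), injective on classes.
* B1 `stub_pinnedLengthMassBound : PinnedLengthMassBound` (XL) — `∀ δ>0 ∃ C ∀ h ∀ v, v₀ = h →
  L(v) := Σ_{tip W = v} |W| x_c^{|W|} ≤ C (h+1)^{1/12+δ}`: the length-weighted Green's function of the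
  renewal walk pinned in column `h` (one block's law: tail sandwich (T1) of the card + heavy-tail local
  renewal estimates, Berger2019-type; contains "span-`h` critical bridges have `x_c`-mean length
  `≤ h^{4/3+δ}`").
* B2 `stub_renewalDensityDecay : RenewalDensityDecay` (L/XL) — `∀ δ>0 ∃ C ∀ h, u_h ≤ C (h+1)^{-1/4+δ}`:
  quantitative infinite mean of the irreducible span (`B_T(x_c) ≍ T^{-1/4}`); in tree only `u_h ≤ 1`
  (`SAWRenewalTightness.StripMassConservation`, Kesten).
* C `stub_disjointnessGain : DisjointnessGain` (XL, hardest, THE BET) — `∃ ε>0 ∃ C ∀ h,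
  M₂(h) ≤ C (h+1)^{-5/6-ε} F(h)`: mutual avoidance of two independent Kesten bridges from adjacent starts up
  to a common apex in column `h` costs `≥ 5/6 + ε` in exponent under the free length-weighted apex-pinned
  pair mass (predicted worth `3/2`; order persistence at common renewal levels — the pair regenerates there,
  the gap is a symmetric i.i.d. walk pinned to `0` at the apex — is worth `≈ 1/2`; the remaining `≥ 1/3 + ε`
  is avoidance BETWEEN renewal levels: second-moment / intersection-local-time territory for two
  INDEPENDENT walks, no tool in tree or print).
* `CriticalBubbleBound_of : A → B1 → B2 → C → SAWTotalPositivity.CriticalBubbleBound` (kernel-checked: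
  `freePairMass_le` (Fubini over the pair sum, pinning the length-weighted bridge at the site forced by the
  other one), `rpow_product` (`-5/6-ε-1/4+ε/4+1/12+ε/4 = -(1+ε/2)`), `tsum_disjointPairMass_ne_top`
  (`p`-series in `ℝ≥0∞`), then A and the landed one-number normal form), and `CriticalBubbleBound_proof` =
  `_of` applied to the four stubs.

**Disproof.lean used** (Cruxes/CriticalBubbleBound/Disproof.lean gen 2–3 and the TEN landed
`Theorems/CriticalBubbleBound/Negative/*.lean`, six of them imported here as the scratch check): there is no
`_false_without_<H>` for a removable hypothesis — §2 `criticalBubbleBound_iff_withoutBoundedPos` shows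
`IsBounded`/`0<δ` idle, and the composition indeed never uses them (it goes through §10's one number); §4
`not_criticalBubbleBoundAt_of_criticalFugacity_lt` (fugacity load-bearing): every mass here is at `x_c`
exactly and Kesten's measure exists only there (`Σ_irr x^{|β|} = 1` iff `x = x_c`); §6 `not_freeEndpointBound`:
no stub frees an endpoint — B1 is PINNED (`tip W = v`) and B2 sums bridges of a fixed SPAN, not all walks
(`u_h ≤ 1` is a theorem, unlike `Σ_v Z = χ = ∞`); §14 `criticalBubbleBound_false_without_selfAvoidance`:
stub A's cut and stub C's avoidance use self-avoidance essentially (for the memory-less walk `M₂ = F`-type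
degeneracy and `u_h ↛ 0`); §15 `not_bubbleCondition_two` (`ℓ² = ∞`): no stub is an `ℓ²`/bubble-diagram
bound — C is a ratio of two pair masses at the same column, B1 a sup, B2 an `ℓ¹`-in-`y` sum at fixed span
(finite: `≤ 1`); §9a (BulkFromBoundary is not glue; multiplicity `m`): honoured — the root multiplicity is
carried explicitly as the length weight `|W₁|+|W₂|` in `pairWeight`, never dropped; §7/§9d target shape
`ClosingBound ε`: this line's sliced form `M₂(h) ≲ h^{-1-ε/2}` is its width-indexed analogue. No stub is an
instance of a landed Negative lemma (none of them negates a bridge-mass, renewal-density or pair-ratio bound).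
-/

noncomputable section

namespace Summit.CriticalPhenomena.SAWScalingLimit.Cruxes.CriticalBubbleBound.KestenProductRenewalDictionary

open Literature.Probability.LatticeModels Literature.Probability.RandomPlanarGeometry
open Literature.Probability.RandomPlanarGeometry.SAW
open Summit.CriticalPhenomena.SAWScalingLimit.Theorems.CriticalBubbleBound.Negative
open scoped ENNReal NNReal BigOperators
open Classical

/-! ### Objects of the dictionary (all over `Zd.bridges`, `Zd.countAt`, `criticalFugacity`) -/

/-- `x_c = 1/μ(ℤ²)`. -/
abbrev xc : ℝ := criticalFugacity

/-- The lattice vector `e₂ = (0,1)` (transverse direction; bridges advance in coordinate `0`). -/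
def eUp : Site 2 := ![0, 1]

@[simp] theorem eUp_zero : eUp 0 = 0 := rfl

/-- A bridge of `ℤ²` from the origin, of any length: `⟨n, ω⟩` with `ω ∈ Zd.bridges 2 n`
(Madras–Slade Def. 1.2.4, first coordinate strictly above the start and maximal at the end).
Under Kesten's critical renewal measure the event "some renewal prefix of Γ equals `W`" has
probability exactly `x_c^{|W|}` (MS (4.2.4): `Σ_{irreducible β} x_c^{|β|} = 1`), which is why
every `x_c`-weighted sum over `Bridge` below is an expectation for an i.i.d. renewal walk. -/
abbrev Bridge : Type := Σ n : ℕ, ↥(Zd.bridges 2 n)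

namespace Bridge

/-- number of steps `|W|` -/
abbrev len (W : Bridge) : ℕ := W.1

/-- the vertex function -/
abbrev fn (W : Bridge) : ℕ → Site 2 := W.2.1

/-- the endpoint (apex) `W(|W|)` -/
abbrev tip (W : Bridge) : Site 2 := W.fn W.len

/-- the span = first coordinate of the endpoint (the renewal LEVEL reached) -/
abbrev span (W : Bridge) : ℤ := W.tip 0

/-- the critical weight `x_c^{|W|}` -/
abbrev mass (W : Bridge) : ℝ≥0∞ := ENNReal.ofReal (xc ^ W.len)

end Bridge

/-- The ROOTED critical series `G_{x_c}(0,e₀) = Σ_n c_n(0,e₀) x_c^n` — literally the normal form of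
the crux (`Negative.criticalBubbleBound_iff_bubble_e₀_ne_top` + `latticeKernel_zero_eq_tsum_countAt`). -/
def rootedSeries : ℝ≥0∞ := ∑' n : ℕ, (Zd.countAt 2 n e₀ : ℝ≥0∞) * ENNReal.ofReal (xc ^ n)

/-- `u_h` — the critical mass of bridges of span `h` (`Σ_{W : span W = h} x_c^{|W|}`): under Kesten's
measure the probability that the renewal walk has a renewal at level `h` (renewal density). -/
def columnMass (h : ℕ) : ℝ≥0∞ := ∑' W : Bridge, if W.span = h then W.mass else 0

/-- `L(v)` — the LENGTH-WEIGHTED critical mass of bridges pinned at the site `v`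
(`Σ_{W : tip W = v} |W| x_c^{|W|}`): the length-weighted Green's function of the 2D renewal walk. -/
def pinnedLengthMass (v : Site 2) : ℝ≥0∞ :=
  ∑' W : Bridge, if W.tip = v then (W.len : ℝ≥0∞) * W.mass else 0

/-- An ordered pair of bridges from the origin; the second one is thought of as translated by `e₂`
(so it starts at `(0,1)`), cf. the lexicographic cut of a rooted polygon in `TwoBridgeBound`. -/
abbrev BridgePair : Type := Bridge × Bridge

/-- the two bridges `W₁` and `W₂ + e₂` END AT THE SAME SITE (common apex) -/
def ApexMeet (p : BridgePair) : Prop := p.1.tip = p.2.tip + eUp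

/-- the common apex lies in column `h` -/
def AtHeight (h : ℕ) (p : BridgePair) : Prop := p.1.span = h

/-- `W₁` and `W₂ + e₂` are vertex-disjoint except at their common endpoint -/
def OnlyApex (p : BridgePair) : Prop :=
  ∀ i ≤ p.1.len, ∀ j ≤ p.2.len, p.1.fn i = p.2.fn j + eUp → i = p.1.len ∧ j = p.2.len

/-- the length-weighted pair weight `(|W₁| + |W₂|) x_c^{|W₁|} x_c^{|W₂|}` -/
def pairWeight (p : BridgePair) : ℝ≥0∞ := ((p.1.len : ℝ≥0∞) + p.2.len) * (p.1.mass * p.2.mass)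

/-- `F(h)` — the FREE (Kesten ⊗ Kesten, no avoidance constraint) length-weighted mass of bridge
pairs meeting at a common apex in column `h`. -/
def freePairMass (h : ℕ) : ℝ≥0∞ :=
  ∑' p : BridgePair, if ApexMeet p ∧ AtHeight h p then pairWeight p else 0

/-- `M₂(h)` — the same mass restricted to pairs that are DISJOINT except at the apex (the image of
the rooted critical polygons of horizontal extent `h` under the lexicographic cut). -/
def disjointPairMass (h : ℕ) : ℝ≥0∞ :=
  ∑' p : BridgePair, if ApexMeet p ∧ AtHeight h p ∧ OnlyApex p then pairWeight p else 0

/-! ### The four stub statements -/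

/-- Stub A (M, combinatorial, provable now) — **two-bridge bound**
`Σ_n c_n(0,e₀) x_c^n ≤ x_c + μ² Σ_h M₂(h)`. Proof plan: `n = 1` gives `x_c` (`c_0(e₀) = 0`, even `n`
vanish by parity, `Negative.countAt_e₀_eq_zero_of_even`); for odd `n ≥ 3` a SAW `0 → e₀` plus the edge
`e₀0` is a polygon `P ∋ {0,e₀}`, and polygons through `{0,e₀}` are the translation classes `[P]` counted
`h(P)` = #horizontal edges times, so the tail is `Σ_{[P]} h(P) x_c^{|P|-1}`. For a class take `B` = the
lexicographically lowest vertex (its `P`-neighbours are `B+e₁`, `B+e₂`) and `A` = the top vertex of the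
rightmost column; `W₁ := (B-e₁) → B → B+e₁ → ⋯ → A` (the arc leaving `B` horizontally) and
`W₂ + e₂ := (B-e₁+e₂) → B+e₂ → ⋯ → A` (the other arc with `B` replaced), translated by `-(B-e₁)`, are
bridges from `0` (coordinate `0` is `> 0` after the start and maximal at `A`) with `ApexMeet`, `AtHeight`
(`h` = width of `P` + 1) and `OnlyApex`; `|W₁|+|W₂| = |P|+1`; `[P] ↦ (W₁,W₂)` is injective
(`P - (B-e₁) = W₁[1..] ∪ (W₂+e₂)[1..] ∪ {W₁(1), W₂(1)+e₂}`); and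
`h(P) x_c^{|P|-1} ≤ μ² (|P|+1) x_c^{|P|+1} = μ² · pairWeight` since `h(P) ≤ |P|`, `μ x_c = 1`. -/
def TwoBridgeBound : Prop :=
  rootedSeries ≤ ENNReal.ofReal xc +
    ENNReal.ofReal (connectiveConstant ^ 2) * ∑' h : ℕ, disjointPairMass h

/-- Stub B1 (XL) — **pinned length-weighted bridge mass**: `sup_{v : v₀ = h} L(v) ≤ C_δ h^{1/12+δ}`
(prediction `h^{4/3} · h^{-5/4}`: mean length `h^{1/ν}` at span `h` times the pinned bridge
two-point function `h^{-2·(5/8)}`). -/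
def PinnedLengthMassBound : Prop :=
  ∀ δ : ℝ, 0 < δ → ∃ C : ℝ≥0, ∀ (h : ℕ) (v : Site 2), v 0 = h →
    pinnedLengthMass v ≤ (C : ℝ≥0∞) * ENNReal.ofReal (((h : ℝ) + 1) ^ ((1 : ℝ) / 12 + δ))

/-- Stub B2 (L/XL) — **renewal density decay**: `u_h ≤ C_δ h^{-1/4+δ}` (prediction
`u_h ≍ h^{θ-1}`, `θ = 3/4` the index of the span of one irreducible bridge; in tree only `u_h ≤ 1`,
`SAWRenewalTightness.StripMassConservation`). -/
def RenewalDensityDecay : Prop :=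
  ∀ δ : ℝ, 0 < δ → ∃ C : ℝ≥0, ∀ h : ℕ,
    columnMass h ≤ (C : ℝ≥0∞) * ENNReal.ofReal (((h : ℝ) + 1) ^ (-(1 : ℝ) / 4 + δ))

/-- Stub C (XL, hardest, the bet) — **disjointness gain ≥ 5/6**: mutual avoidance of the two bridges
up to their common apex costs at least `h^{-5/6-ε}` under the free length-weighted apex-pinned pair
mass (prediction `h^{-3/2}` = two boundary two-leg fusions `3/4 + 3/4`; regeneration-level
Sparre Andersen persistence certifies ≤ `1/2`). -/
def DisjointnessGain : Prop :=
  ∃ ε : ℝ, 0 < ε ∧ ∃ C : ℝ≥0, ∀ h : ℕ,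
    disjointPairMass h ≤
      (C : ℝ≥0∞) * ENNReal.ofReal (((h : ℝ) + 1) ^ (-(5 : ℝ) / 6 - ε)) * freePairMass h

/-! ### Audit names of the stub statements (`Goal.stub_x` = statement of the registered stub
`stub_x`, so that `#h21_check_skeleton` reads the hypotheses of `CriticalBubbleBound_of` by name) -/

namespace Goal

/-- Statement of stub A `stub_twoBridgeBound`. -/
abbrev stub_twoBridgeBound : Prop := TwoBridgeBound

/-- Statement of stub B1 `stub_pinnedLengthMassBound`. -/
abbrev stub_pinnedLengthMassBound : Prop := PinnedLengthMassBound

/-- Statement of stub B2 `stub_renewalDensityDecay`. -/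
abbrev stub_renewalDensityDecay : Prop := RenewalDensityDecay

/-- Statement of stub C `stub_disjointnessGain`. -/
abbrev stub_disjointnessGain : Prop := DisjointnessGain

end Goal

/-! ### Registered stubs -/

/-- Stub A (M): the lexicographic two-bridge cut of rooted critical polygons. -/
theorem stub_twoBridgeBound : TwoBridgeBound := by
  sorry

/-- Stub B1 (XL): pinned length-weighted bridge mass `≤ C_δ h^{1/12+δ}`. -/
theorem stub_pinnedLengthMassBound : PinnedLengthMassBound := by
  sorry

/-- Stub B2 (L/XL): renewal density `u_h ≤ C_δ h^{-1/4+δ}`. -/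
theorem stub_renewalDensityDecay : RenewalDensityDecay := by
  sorry

/-- Stub C (XL, hardest): disjointness gain `≥ 5/6 + ε`. -/
theorem stub_disjointnessGain : DisjointnessGain := by
  sorry

/-! ### Kernel-checked composition -/

/-- Fubini step (proved): the free pair mass factorises through the one-bridge quantities —
pin the length-weighted bridge at the site dictated by the other one:
`F(h) ≤ 2 · u_h · sup_{v₀ = h} L(v)`. -/
theorem freePairMass_le (h : ℕ) (B : ℝ≥0∞)
    (hB : ∀ v : Site 2, v 0 = h → pinnedLengthMass v ≤ B) :
    freePairMass h ≤ 2 * (columnMass h * B) := by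
  -- the two summands of the length weight, each pinned at the site forced by the other bridge
  let f₁ : BridgePair → ℝ≥0∞ := fun p =>
    (if p.2.span = h then p.2.mass else 0) *
      (if p.1.tip = p.2.tip + eUp then (p.1.len : ℝ≥0∞) * p.1.mass else 0)
  let f₂ : BridgePair → ℝ≥0∞ := fun p =>
    (if p.1.span = h then p.1.mass else 0) *
      (if p.2.tip = p.1.tip - eUp then (p.2.len : ℝ≥0∞) * p.2.mass else 0)
  have hterm : ∀ p : BridgePair,
      (if ApexMeet p ∧ AtHeight h p then pairWeight p else 0) ≤ f₁ p + f₂ p := by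
    intro p
    by_cases hp : ApexMeet p ∧ AtHeight h p
    · obtain ⟨hA, hH⟩ := hp
      have hA' : p.1.tip = p.2.tip + eUp := hA
      have hH' : p.1.span = h := hH
      have h2span : p.2.span = h := by
        have := congrFun hA' 0
        simp only [Pi.add_apply, eUp_zero, add_zero] at this
        rw [← hH']
        exact this.symm
      have hB2 : p.2.tip = p.1.tip - eUp := by rw [hA', add_sub_cancel_right]
      rw [if_pos ⟨hA, hH⟩]
      simp only [f₁, f₂, if_pos h2span, if_pos hA', if_pos hH', if_pos hB2, pairWeight]
      apply le_of_eq
      ring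
    · rw [if_neg hp]
      exact zero_le
  have hpin₁ : ∀ b : Bridge, b.span = h → pinnedLengthMass (b.tip + eUp) ≤ B := fun b hb =>
    hB _ (by simp [hb])
  have hpin₂ : ∀ a : Bridge, a.span = h → pinnedLengthMass (a.tip - eUp) ≤ B := fun a ha =>
    hB _ (by simp [ha])
  calc freePairMass h
      ≤ ∑' p : BridgePair, (f₁ p + f₂ p) := ENNReal.tsum_le_tsum hterm
    _ = (∑' p : BridgePair, f₁ p) + ∑' p : BridgePair, f₂ p := ENNReal.tsum_add
    _ ≤ columnMass h * B + columnMass h * B := by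
        gcongr
        · -- sum over the second bridge outermost
          rw [ENNReal.tsum_prod', ENNReal.tsum_comm]
          calc ∑' (b : Bridge) (a : Bridge), f₁ (a, b)
              = ∑' b : Bridge, (if b.span = h then b.mass else 0) *
                  ∑' a : Bridge, (if a.tip = b.tip + eUp then (a.len : ℝ≥0∞) * a.mass else 0) := by
                refine tsum_congr fun b => ?_
                rw [← ENNReal.tsum_mul_left]
            _ ≤ ∑' b : Bridge, (if b.span = h then b.mass else 0) * B := by
                refine ENNReal.tsum_le_tsum fun b => ?_
                by_cases hb : b.span = h
                · rw [if_pos hb]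
                  exact mul_le_mul' le_rfl (hpin₁ b hb)
                · rw [if_neg hb, zero_mul, zero_mul]
            _ = columnMass h * B := ENNReal.tsum_mul_right
        · rw [ENNReal.tsum_prod']
          calc ∑' (a : Bridge) (b : Bridge), f₂ (a, b)
              = ∑' a : Bridge, (if a.span = h then a.mass else 0) *
                  ∑' b : Bridge, (if b.tip = a.tip - eUp then (b.len : ℝ≥0∞) * b.mass else 0) := by
                refine tsum_congr fun a => ?_
                rw [← ENNReal.tsum_mul_left]
            _ ≤ ∑' a : Bridge, (if a.span = h then a.mass else 0) * B := by
                refine ENNReal.tsum_le_tsum fun a => ?_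
                by_cases ha : a.span = h
                · rw [if_pos ha]
                  exact mul_le_mul' le_rfl (hpin₂ a ha)
                · rw [if_neg ha, zero_mul, zero_mul]
            _ = columnMass h * B := ENNReal.tsum_mul_right
    _ = 2 * (columnMass h * B) := (two_mul _).symm

/-- Exponent bookkeeping (proved): `-5/6 - ε`, `-1/4 + ε/4`, `1/12 + ε/4` add up to `-(1 + ε/2)`. -/
theorem rpow_product (ε : ℝ) {t : ℝ} (ht : 0 < t) :
    ENNReal.ofReal (t ^ (-(5 : ℝ) / 6 - ε)) * ENNReal.ofReal (t ^ (-(1 : ℝ) / 4 + ε / 4)) *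
        ENNReal.ofReal (t ^ ((1 : ℝ) / 12 + ε / 4)) =
      ENNReal.ofReal (t ^ (-(1 + ε / 2))) := by
  rw [← ENNReal.ofReal_mul (Real.rpow_nonneg ht.le _), ← ENNReal.ofReal_mul
    (mul_nonneg (Real.rpow_nonneg ht.le _) (Real.rpow_nonneg ht.le _)),
    ← Real.rpow_add ht, ← Real.rpow_add ht]
  congr 2
  ring

/-- Summation step (proved): a `p`-series bound on the sliced disjoint pair masses makes their
total finite. -/
theorem tsum_disjointPairMass_ne_top {K : ℝ≥0∞} (hK : K ≠ ⊤) {ε : ℝ} (hε : 0 < ε)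
    (hle : ∀ h : ℕ, disjointPairMass h ≤ K * ENNReal.ofReal (((h : ℝ) + 1) ^ (-(1 + ε / 2)))) :
    ∑' h : ℕ, disjointPairMass h ≠ ⊤ := by
  refine ne_top_of_le_ne_top ?_ (ENNReal.tsum_le_tsum hle)
  rw [ENNReal.tsum_mul_left]
  refine ENNReal.mul_ne_top hK ?_
  have hs : Summable fun n : ℕ => ((n : ℝ) + 1) ^ (-(1 + ε / 2)) := by
    have h1 : Summable fun n : ℕ => ((n : ℝ)) ^ (-(1 + ε / 2)) :=
      Real.summable_nat_rpow.2 (by linarith)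
    simpa using (summable_nat_add_iff 1).2 h1
  rw [← ENNReal.ofReal_tsum_of_nonneg (fun n => Real.rpow_nonneg (by positivity) _) hs]
  exact ENNReal.ofReal_ne_top

/-- **The composition**: the four stubs imply the crux BY NAME. Chain: C bounds `M₂(h)` by
`h^{-5/6-ε} F(h)`; the Fubini step and B2, B1 (at `δ = ε/4`) bound `F(h)` by
`2 C₂ C₃ h^{-1/4+δ} h^{1/12+δ}`; the exponents add to `-(1+ε/2)`, so `Σ_h M₂(h) < ∞`; A bounds the
rooted series by `x_c + μ² Σ_h M₂(h) < ∞`; the landed one-number normal form closes. -/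
theorem CriticalBubbleBound_of :
    Goal.stub_twoBridgeBound → Goal.stub_pinnedLengthMassBound → Goal.stub_renewalDensityDecay →
      Goal.stub_disjointnessGain →
      _root_.Summit.CriticalPhenomena.SAWScalingLimit.Theses.SAWTotalPositivity.CriticalBubbleBound := by
  intro hA hB1 hB2 hC
  obtain ⟨ε, hε, C₁, hC₁⟩ := hC
  obtain ⟨C₂, hC₂⟩ := hB2 (ε / 4) (by positivity)
  obtain ⟨C₃, hC₃⟩ := hB1 (ε / 4) (by positivity)
  -- per-column bound with summable exponent
  have hcol : ∀ h : ℕ, disjointPairMass h ≤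
      (2 * C₁ * C₂ * C₃ : ℝ≥0∞) * ENNReal.ofReal (((h : ℝ) + 1) ^ (-(1 + ε / 2))) := by
    intro h
    have ht : (0 : ℝ) < (h : ℝ) + 1 := by positivity
    have hF : freePairMass h ≤ 2 * (columnMass h *
        ((C₃ : ℝ≥0∞) * ENNReal.ofReal (((h : ℝ) + 1) ^ ((1 : ℝ) / 12 + ε / 4)))) :=
      freePairMass_le h _ (fun v hv => hC₃ h v hv)
    calc disjointPairMass h
        ≤ (C₁ : ℝ≥0∞) * ENNReal.ofReal (((h : ℝ) + 1) ^ (-(5 : ℝ) / 6 - ε)) * freePairMass h := hC₁ h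
      _ ≤ (C₁ : ℝ≥0∞) * ENNReal.ofReal (((h : ℝ) + 1) ^ (-(5 : ℝ) / 6 - ε)) *
            (2 * (((C₂ : ℝ≥0∞) * ENNReal.ofReal (((h : ℝ) + 1) ^ (-(1 : ℝ) / 4 + ε / 4))) *
              ((C₃ : ℝ≥0∞) * ENNReal.ofReal (((h : ℝ) + 1) ^ ((1 : ℝ) / 12 + ε / 4))))) := by
          gcongr
          exact hF.trans (by gcongr; exact hC₂ h)
      _ = (2 * C₁ * C₂ * C₃ : ℝ≥0∞) *
            (ENNReal.ofReal (((h : ℝ) + 1) ^ (-(5 : ℝ) / 6 - ε)) *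
              ENNReal.ofReal (((h : ℝ) + 1) ^ (-(1 : ℝ) / 4 + ε / 4)) *
              ENNReal.ofReal (((h : ℝ) + 1) ^ ((1 : ℝ) / 12 + ε / 4))) := by ring
      _ = (2 * C₁ * C₂ * C₃ : ℝ≥0∞) * ENNReal.ofReal (((h : ℝ) + 1) ^ (-(1 + ε / 2))) := by
          rw [rpow_product ε ht]
  have hK : (2 * C₁ * C₂ * C₃ : ℝ≥0∞) ≠ ⊤ := by
    refine ENNReal.mul_ne_top (ENNReal.mul_ne_top (ENNReal.mul_ne_top ?_ ENNReal.coe_ne_top)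
      ENNReal.coe_ne_top) ENNReal.coe_ne_top
    exact ENNReal.ofNat_ne_top
  have hsum : ∑' h : ℕ, disjointPairMass h ≠ ⊤ := tsum_disjointPairMass_ne_top hK hε hcol
  -- the rooted series is finite
  have hroot : rootedSeries ≠ ⊤ := by
    refine ne_top_of_le_ne_top ?_ hA
    exact ENNReal.add_ne_top.2 ⟨ENNReal.ofReal_ne_top, ENNReal.mul_ne_top ENNReal.ofReal_ne_top hsum⟩
  -- the landed one-number normal form of the crux
  rw [criticalBubbleBound_iff_bubble_e₀_ne_top, bubble, latticeKernel_zero_eq_tsum_countAt]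
  exact hroot

/-- The skeleton as a (sorried-through-the-stubs) proof of the crux: `_of` applied to the stubs. -/
theorem CriticalBubbleBound_proof :
    _root_.Summit.CriticalPhenomena.SAWScalingLimit.Theses.SAWTotalPositivity.CriticalBubbleBound :=
  CriticalBubbleBound_of stub_twoBridgeBound stub_pinnedLengthMassBound stub_renewalDensityDecay
    stub_disjointnessGain

end Summit.CriticalPhenomena.SAWScalingLimit.Cruxes.CriticalBubbleBound.KestenProductRenewalDictionary

end
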